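import Literature.Analysis.DeBrangesSpaces.BurnolSonineCommonZerosProofs
import Literature.Analysis.Fourier.L2FourierMultiplication
import Literature.Analysis.FunctionSpaces.PlancherelL1L2
import HarnessLib

/-!
# Burnol, *Sur certains espaces de Hilbert de fonctions entières …* (CRAS 333 (2001) 201–206) —
the functional equation (1.1) for the Mellin transforms of `K_{a,b}`, as an identity of entire
functions

Burnol's eq. (1.1) (TeX l.279–281): "presque partout sur la droite critique:
`∀ f ∈ K, f̂(s) = γ₊(s)·(𝓕₊f)^(1−s)`".  For `f ∈ K_{a,b}` both `f̂` and `(𝓕₊f)^` have ENTIRE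
continuations (Théorème 1.1; in the tree `G_f = sonineMellinExt a b (𝓕f)` and
`G_{𝓕f} = sonineMellinExt b a f`, `SonineMellinEntire.lean`), and we prove the identity of entire
functions on the junk-free half-plane `Re s > 0` (`gammaPlus` is Mathlib-faithful there):

  `G_f(s) = γ₊(s) · G_{𝓕f}(1 − s)`,  `0 < Re s`   (`sonineMellinExt_fourier_eq_gammaPlus_mul`).

Road (Burnol proves (1.3) FROM (1.1); the tree proved the closed form (1.3) directly —
`IsBurnolC.eq_closedForm`, p436923 — so here (1.1) is DERIVED from (1.3)): for `Re s > 1`,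
`G_f(s) = ∫_b^∞ 𝓕f(u) C_a(u,s) du` (eq. (1.2)) and `C_a(u,s) = γ₊(s)u^{−s} − D_a(u,s)` with
`D_a(u,s) = 2∫_0^a cos(2πut)t^{s−1}dt = 𝓕(𝟙_{|t|<a}|t|^{s−1})(u)`; the first piece gives
`γ₊(s)·∫_b^∞ 𝓕f(u)u^{−s}du = γ₊(s)·(𝓕f)^(1−s) = γ₊(s) G_{𝓕f}(1−s)`, and the second vanishes by the
`L²` multiplication formula (`∫ 𝓕f · 𝓕h = ∫ f · h = 0`, `h` living on `(−a,a)` where `f = 0`); the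
identity theorem extends the equality from `Re s > 1` to `Re s > 0`.

Consequence (`exists_compensated_pairing_fn`): for every `f ∈ K_{λ,λ}` with entire Mellin continuation
`G`, the compensated pairing function of Théorème 1.5 EXISTS in the faithful sense
(`P` entire, `P(v) = γ₊(v)G(1−v)` on `Re v > 0`): `P = G_{𝓕f}`.  This is the non-vacuity of the
hypothesis of `Burnol2001CRAS_thm1_5C` (the statement `IsXPairingFnC G P` unfolded, so that this file
does not depend on that definition).

RH-FREE throughout.

## References
* [Burnol2001CRAS] J.-F. Burnol, C. R. Acad. Sci. Paris 333 (2001) 201–206, §1, eq. (1.1)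
  (TeX l.279–281), (1.2) (l.326–332), (1.3) (l.352–355), Thm. 1.5 (l.398–408).
* [Grafakos2014] L. Grafakos, *Classical Fourier Analysis*, Thm. 2.2.14 (1) (multiplication formula).
-/

open MeasureTheory Set Filter Complex FourierTransform
open scoped Real Topology ENNReal FourierTransform ComplexConjugate

open Literature.NumberTheory.ConnesConsani2021 (soninSpace)
open Literature.Analysis.Fourier (coeFn_compNeg compNeg_compNeg fourier_compNeg
  fourier_fourier_eq_compNeg integral_mul_fourier_eq integral_fourier_mul_eq)
open Literature.Analysis.FunctionSpaces (fourier_toLp_ae_eq_fourierIntegral)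
open Literature.Analysis.DeBrangesSpaces.SonineMellin (cosKernel sonineMellinExt cosKernel_neg
  differentiable_cosKernel cosKernel_eq_burnolC differentiable_sonineMellinExt
  sonineMellinExt_eq_mellin)

namespace Literature.Analysis.DeBrangesSpaces

namespace Burnol2001

/-! ## A. Half-line bookkeeping for even integrable functions -/

/-- `∫_ℝ φ = ∫_{(0,∞)} (φ(x) + φ(−x)) dx` for integrable `φ`. [folklore] -/
private theorem integral_eq_integral_Ioi_add_neg' {φ : ℝ → ℂ} (hφ : Integrable φ) :
    ∫ x, φ x = ∫ x in Ioi 0, (φ x + φ (-x)) := by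
  have h1 : IntegrableOn φ (Iic 0) := hφ.integrableOn
  have h2 : IntegrableOn φ (Ioi 0) := hφ.integrableOn
  have h3 : IntegrableOn (fun x ↦ φ (-x)) (Ioi 0) := hφ.comp_neg.integrableOn
  rw [← intervalIntegral.integral_Iic_add_Ioi h1 h2, integral_add h2 h3, add_comm]
  congr 1
  rw [integral_comp_neg_Ioi]; simp

/-- For `φ` integrable, a.e. even and a.e. zero on `[−b,b]` (`b > 0`): `∫_ℝ φ = 2∫_{(b,∞)} φ`.
[folklore] -/
private theorem integral_eq_two_mul_setIntegral_Ioi {φ : ℝ → ℂ} {b : ℝ} (hb : 0 < b)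
    (hφ : Integrable φ) (heven : ∀ᵐ x : ℝ, φ (-x) = φ x)
    (hzero : ∀ᵐ x : ℝ, x ∈ Icc (-b) b → φ x = 0) :
    ∫ x, φ x = 2 * ∫ x in Ioi b, φ x := by
  rw [integral_eq_integral_Ioi_add_neg' hφ]
  have e1 : ∫ x in Ioi 0, (φ x + φ (-x)) = ∫ x in Ioi 0, 2 * φ x := by
    refine integral_congr_ae ?_
    filter_upwards [ae_restrict_of_ae (s := Ioi 0) heven] with x hx
    rw [hx]; ring
  rw [e1, integral_const_mul]
  congr 1
  have hI : IntegrableOn φ (Ioi 0) := hφ.integrableOn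
  rw [← Ioc_union_Ioi_eq_Ioi hb.le, setIntegral_union (Set.Ioc_disjoint_Ioi le_rfl)
    measurableSet_Ioi (hI.mono_set Ioc_subset_Ioi_self) (hI.mono_set (Ioi_subset_Ioi hb.le))]
  have e2 : ∫ x in Ioc 0 b, φ x = 0 := by
    refine integral_eq_zero_of_ae ?_
    filter_upwards [ae_restrict_mem measurableSet_Ioc, ae_restrict_of_ae (s := Ioc 0 b) hzero]
      with x hx hz
    exact hz ⟨by linarith [hx.1], hx.2⟩
  rw [e2, zero_add]

/-! ## B. The test function `h_s = 𝟙_{(−a,a)}·|t|^{s−1}` (`Re s > 1`) and its Fourier transform -/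

/-- `|t|^{s−1}` is continuous for `Re s > 1`. [folklore] -/
private theorem continuous_abs_cpow {s : ℂ} (hs : 1 < s.re) :
    Continuous fun t : ℝ ↦ ((|t| : ℝ) : ℂ) ^ (s - 1) :=
  (Complex.continuous_ofReal_cpow_const (by rw [sub_re, one_re]; linarith)).comp continuous_abs

/-- `h_s` is integrable. [folklore] -/
private theorem integrable_hs (a : ℝ) {s : ℂ} (hs : 1 < s.re) :
    Integrable ((Ioo (-a) a).indicator fun t : ℝ ↦ ((|t| : ℝ) : ℂ) ^ (s - 1)) := by
  rw [integrable_indicator_iff measurableSet_Ioo]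
  exact ((continuous_abs_cpow hs).continuousOn.integrableOn_compact isCompact_Icc).mono_set
    Ioo_subset_Icc_self

/-- `h_s ∈ L²`. [folklore] -/
private theorem memLp_hs (a : ℝ) {s : ℂ} (hs : 1 < s.re) :
    MemLp ((Ioo (-a) a).indicator fun t : ℝ ↦ ((|t| : ℝ) : ℂ) ^ (s - 1)) 2 (volume : Measure ℝ) := by
  rw [memLp_indicator_iff_restrict measurableSet_Ioo]
  have hc := continuous_abs_cpow hs
  obtain ⟨C, hC⟩ : ∃ C, ∀ t ∈ Icc (-a) a, ‖((|t| : ℝ) : ℂ) ^ (s - 1)‖ ≤ C := by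
    have hK := isCompact_Icc.exists_bound_of_continuousOn (f := fun t : ℝ ↦ ((|t| : ℝ) : ℂ) ^ (s - 1))
      (s := Icc (-a) a) hc.continuousOn
    exact hK
  refine MemLp.of_bound hc.aestronglyMeasurable C ?_
  filter_upwards [ae_restrict_mem measurableSet_Ioo] with t ht
  exact hC t (Ioo_subset_Icc_self ht)

/-- `h_s` is even. [folklore] -/
private theorem hs_neg (a : ℝ) (s : ℂ) (t : ℝ) :
    (Ioo (-a) a).indicator (fun t : ℝ ↦ ((|t| : ℝ) : ℂ) ^ (s - 1)) (-t) =
      (Ioo (-a) a).indicator (fun t : ℝ ↦ ((|t| : ℝ) : ℂ) ^ (s - 1)) t := by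
  by_cases ht : t ∈ Ioo (-a) a
  · have ht' : -t ∈ Ioo (-a) a := by
      rw [mem_Ioo] at ht ⊢; constructor <;> linarith [ht.1, ht.2]
    rw [Set.indicator_of_mem ht, Set.indicator_of_mem ht', abs_neg]
  · have ht' : -t ∉ Ioo (-a) a := by
      intro h; apply ht; rw [mem_Ioo] at h ⊢; constructor <;> linarith [h.1, h.2]
    rw [Set.indicator_of_notMem ht, Set.indicator_of_notMem ht']

/-- **`𝓕(𝟙_{(−a,a)}|t|^{s−1})(u) = 2∫_0^a cos(2πut) t^{s−1} dt = D_a(u,s)`** (`a > 0`, `Re s > 1`).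
[cite: Burnol2001CRAS, §1 (TeX l.349–352)] -/
theorem fourier_indicator_abs_cpow (a : ℝ) {s : ℂ} (hs : 1 < s.re) (u : ℝ) :
    𝓕 ((Ioo (-a) a).indicator fun t : ℝ ↦ ((|t| : ℝ) : ℂ) ^ (s - 1)) u =
      2 * ∫ t in Ioc 0 a, ((Real.cos (2 * π * u * t) : ℝ) : ℂ) * (t : ℂ) ^ (s - 1) := by
  rw [Real.fourier_real_eq_integral_exp_smul]
  have hint : Integrable fun v : ℝ ↦ cexp (↑(-2 * π * v * u) * I) •
      (Ioo (-a) a).indicator (fun t : ℝ ↦ ((|t| : ℝ) : ℂ) ^ (s - 1)) v := by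
    refine (integrable_hs a hs).norm.mono' ?_ (Eventually.of_forall fun v ↦ ?_)
    · exact ((by fun_prop : Continuous fun v : ℝ ↦ cexp (↑(-2 * π * v * u) * I)).aestronglyMeasurable).smul
        (integrable_hs a hs).aestronglyMeasurable
    · rw [norm_smul, Complex.norm_exp_ofReal_mul_I, one_mul]
  rw [integral_eq_integral_Ioi_add_neg' hint]
  have e1 : ∫ v in Ioi 0, (cexp (↑(-2 * π * v * u) * I) •
        (Ioo (-a) a).indicator (fun t : ℝ ↦ ((|t| : ℝ) : ℂ) ^ (s - 1)) v +
      cexp (↑(-2 * π * -v * u) * I) •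
        (Ioo (-a) a).indicator (fun t : ℝ ↦ ((|t| : ℝ) : ℂ) ^ (s - 1)) (-v)) =
      ∫ v in Ioi 0, (Ioo 0 a).indicator
        (fun t : ℝ ↦ 2 * (((Real.cos (2 * π * u * t) : ℝ) : ℂ) * (t : ℂ) ^ (s - 1))) v := by
    refine setIntegral_congr_fun measurableSet_Ioi fun v hv ↦ ?_
    have hv0 : (0 : ℝ) < v := hv
    rw [hs_neg, ← add_smul]
    by_cases hva : v < a
    · have hv1 : v ∈ Ioo (-a) a := ⟨by linarith, hva⟩
      have hv2 : v ∈ Ioo 0 a := ⟨hv0, hva⟩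
      rw [Set.indicator_of_mem hv1, Set.indicator_of_mem hv2, smul_eq_mul, abs_of_pos hv0,
        Complex.ofReal_cos, ← mul_assoc, Complex.two_cos]
      congr 1
      rw [add_comm]
      congr 1 <;> (congr 1; push_cast; ring)
    · have hv1 : v ∉ Ioo (-a) a := fun h ↦ hva h.2
      have hv2 : v ∉ Ioo 0 a := fun h ↦ hva h.2
      rw [Set.indicator_of_notMem hv1, Set.indicator_of_notMem hv2, smul_zero]
  rw [e1, setIntegral_indicator measurableSet_Ioo,
    show Ioi (0 : ℝ) ∩ Ioo 0 a = Ioo 0 a from inter_eq_right.2 Ioo_subset_Ioi_self,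
    setIntegral_congr_set Ioo_ae_eq_Ioc, integral_const_mul]

/-! ## C. The second piece of the closed form integrates to zero against `𝓕f` -/

section Main

variable {a b : ℝ} (ha : 0 < a) (hb : 0 < b) {f : Lp ℂ 2 (volume : Measure ℝ)}
  (hf : f ∈ soninSpace a b)

/-- `u ↦ u^{−s}` is square integrable on `(b,∞)` for `Re s > 1/2` (`b > 0`). [folklore] -/
private theorem memLp_cpow_neg_restrict_Ioi {b : ℝ} (hb : 0 < b) {s : ℂ} (hs : 1 / 2 < s.re) :
    MemLp (fun u : ℝ ↦ (u : ℂ) ^ (-s)) 2 (volume.restrict (Ioi b)) := by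
  have hmeas : AEStronglyMeasurable (fun u : ℝ ↦ (u : ℂ) ^ (-s)) (volume.restrict (Ioi b)) := by
    refine ContinuousOn.aestronglyMeasurable (fun u hu ↦ ?_) measurableSet_Ioi
    exact (Complex.continuousAt_ofReal_cpow_const _ _ (Or.inr (hb.trans hu).ne')).continuousWithinAt
  rw [memLp_two_iff_integrable_sq_norm hmeas]
  have hint := integrableOn_Ioi_rpow_of_lt (by linarith : -(2 * s.re) < -1) hb
  refine hint.congr_fun (fun u hu ↦ ?_) measurableSet_Ioi
  have hu0 : 0 < u := hb.trans hu
  dsimp only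
  rw [Complex.norm_cpow_eq_rpow_re_of_pos hu0, ← Real.rpow_natCast, ← Real.rpow_mul hu0.le]
  congr 1
  simp only [neg_re, Nat.cast_ofNat]
  ring

include hb in
/-- `𝓕f · u^{−s}` is integrable on `(b,∞)` for `Re s > 1/2`. [folklore] -/
private theorem integrableOn_fourier_mul_cpow {s : ℂ} (hs : 1 / 2 < s.re) :
    IntegrableOn (fun u : ℝ ↦ ((𝓕 f : Lp ℂ 2 (volume : Measure ℝ)) : ℝ → ℂ) u * (u : ℂ) ^ (-s))
      (Ioi b) :=
  ((Lp.memLp (𝓕 f : Lp ℂ 2 (volume : Measure ℝ))).restrict (Ioi b)).integrable_mul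
    (memLp_cpow_neg_restrict_Ioi hb hs)

include ha hb hf in
/-- **`∫_b^∞ 𝓕f(u)·u^{−s} du = G_{𝓕f}(1 − s)`** for `Re s > 1/2`: the integral is `(𝓕f)^(1−s)`
(`𝓕f = 0` on `(0,b)`), continued by `sonineMellinExt b a f` (eq. (1.2) for `𝓕f ∈ K_{b,a}`,
`𝓕𝓕f = f`). [cite: Burnol2001CRAS, eq. (1.2) (TeX l.326–332)] -/
theorem setIntegral_fourier_mul_cpow {s : ℂ} (hs : 1 / 2 < s.re) :
    ∫ u in Ioi b, ((𝓕 f : Lp ℂ 2 (volume : Measure ℝ)) : ℝ → ℂ) u * (u : ℂ) ^ (-s) =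
      sonineMellinExt b a (f : ℝ → ℂ) (1 - s) := by
  obtain ⟨hFmem, hFF⟩ := fourier_mem_soninSpace_swap hf
  obtain ⟨hFeven, hFb, hFFa⟩ := hFmem
  have h1 := sonineMellinExt_eq_mellin hb ha (𝓕 f : Lp ℂ 2 (volume : Measure ℝ)) hFeven hFb hFFa
    (w := 1 - s) (by rw [sub_re, one_re]; linarith)
  rw [hFF] at h1
  rw [h1, mellin]
  -- `∫_{(0,∞)} u^{(1−s)−1} 𝓕f(u) du = ∫_{(b,∞)} 𝓕f(u) u^{−s} du`
  have hI2 : IntegrableOn (fun u : ℝ ↦ (u : ℂ) ^ (1 - s - 1) •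
      ((𝓕 f : Lp ℂ 2 (volume : Measure ℝ)) : ℝ → ℂ) u) (Ioi b) := by
    refine (integrableOn_fourier_mul_cpow (f := f) hb hs).congr_fun (fun u _ ↦ ?_) measurableSet_Ioi
    rw [smul_eq_mul, mul_comm, show (1 - s - 1 : ℂ) = -s by ring]
  have hI1 : IntegrableOn (fun u : ℝ ↦ (u : ℂ) ^ (1 - s - 1) •
      ((𝓕 f : Lp ℂ 2 (volume : Measure ℝ)) : ℝ → ℂ) u) (Ioc 0 b) := by
    refine integrableOn_zero.congr_fun_ae ?_
    filter_upwards [ae_restrict_mem measurableSet_Ioc, ae_restrict_of_ae (s := Ioc 0 b) hFb]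
      with u hu hz
    rw [hz ⟨by linarith [hu.1], hu.2⟩, smul_zero]
  rw [← Ioc_union_Ioi_eq_Ioi hb.le, setIntegral_union (Set.Ioc_disjoint_Ioi le_rfl)
    measurableSet_Ioi hI1 hI2]
  have e1 : ∫ u in Ioc 0 b, (u : ℂ) ^ (1 - s - 1) •
      ((𝓕 f : Lp ℂ 2 (volume : Measure ℝ)) : ℝ → ℂ) u = 0 := by
    refine integral_eq_zero_of_ae ?_
    filter_upwards [ae_restrict_mem measurableSet_Ioc, ae_restrict_of_ae (s := Ioc 0 b) hFb]
      with u hu hz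
    rw [Pi.zero_apply, hz ⟨by linarith [hu.1], hu.2⟩, smul_zero]
  rw [e1, zero_add]
  refine setIntegral_congr_fun measurableSet_Ioi (fun u _ ↦ ?_)
  rw [smul_eq_mul, mul_comm, show (1 - s - 1 : ℂ) = -s by ring]

include hb hf in
/-- **`∫_b^∞ 𝓕f(u)·D_a(u,s) du = 0`** for `Re s > 1`, `D_a(u,s) = 2∫_0^a cos(2πut)t^{s−1}dt = 𝓕h_s(u)`,
`h_s = 𝟙_{(−a,a)}|t|^{s−1}`: by evenness `∫_b^∞ = ½∫_ℝ`, and `∫ 𝓕f·𝓕h_s = ∫ f·h_s = 0` since `f`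
vanishes on `(−a,a)` (multiplication formula, `𝓕𝓕 = 1` on even classes).
[cite: Burnol2001CRAS, §1 (TeX l.349–355)] -/
theorem setIntegral_fourier_mul_cosIntegral_eq_zero {s : ℂ} (hs : 1 < s.re) :
    ∫ u in Ioi b, ((𝓕 f : Lp ℂ 2 (volume : Measure ℝ)) : ℝ → ℂ) u *
      (2 * ∫ t in Ioc 0 a, ((Real.cos (2 * π * u * t) : ℝ) : ℂ) * (t : ℂ) ^ (s - 1)) = 0 := by
  obtain ⟨hFmem, hFF⟩ := fourier_mem_soninSpace_swap hf
  obtain ⟨hFeven, hFb, _⟩ := hFmem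
  obtain ⟨_, hfa, _⟩ := hf
  set F : Lp ℂ 2 (volume : Measure ℝ) := 𝓕 f with hFdef
  -- the class `H` of `h_s`
  have hh1 := integrable_hs a hs
  have hh2 := memLp_hs a hs
  set H : Lp ℂ 2 (volume : Measure ℝ) := hh2.toLp _ with hHdef
  have hHcoe : (H : ℝ → ℂ) =ᵐ[volume] (Ioo (-a) a).indicator (fun t : ℝ ↦ ((|t| : ℝ) : ℂ) ^ (s - 1)) :=
    hh2.coeFn_toLp
  have hq : Measure.QuasiMeasurePreserving (fun x : ℝ ↦ -x) volume volume :=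
    (Measure.measurePreserving_neg (volume : Measure ℝ)).quasiMeasurePreserving
  -- `H` is even, so `𝓕𝓕H = H` and `𝓕H` is even
  have hRH : Lp.compMeasurePreserving (fun x : ℝ ↦ -x)
      (Measure.measurePreserving_neg (volume : Measure ℝ)) H = H := by
    refine Lp.ext ?_
    filter_upwards [coeFn_compNeg (F := ℂ) H, hHcoe, hq.ae_eq_comp hHcoe] with x h1 h2 h3
    rw [h1]
    simp only [Function.comp_apply] at h3
    rw [h3, hs_neg, h2]
  have hFFH : (𝓕 (𝓕 H : Lp ℂ 2 (volume : Measure ℝ)) : Lp ℂ 2 (volume : Measure ℝ)) = H := by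
    rw [fourier_fourier_eq_compNeg, hRH]
  have hFH_even : ∀ᵐ x : ℝ, ((𝓕 H : Lp ℂ 2 (volume : Measure ℝ)) : ℝ → ℂ) (-x) =
      ((𝓕 H : Lp ℂ 2 (volume : Measure ℝ)) : ℝ → ℂ) x := by
    have h1 := coeFn_compNeg (F := ℂ) (𝓕 H : Lp ℂ 2 (volume : Measure ℝ))
    rw [← fourier_compNeg, hRH] at h1
    filter_upwards [h1] with x hx
    exact hx.symm
  -- `𝓕H = D_a(·,s)` a.e.
  have hFH : ∀ᵐ u : ℝ, ((𝓕 H : Lp ℂ 2 (volume : Measure ℝ)) : ℝ → ℂ) u =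
      2 * ∫ t in Ioc 0 a, ((Real.cos (2 * π * u * t) : ℝ) : ℂ) * (t : ℂ) ^ (s - 1) := by
    filter_upwards [fourier_toLp_ae_eq_fourierIntegral hh1 hh2] with u hu
    rw [hHdef, hu, fourier_indicator_abs_cpow a hs]
  -- the integrable function `φ = 𝓕f · 𝓕H`: even, zero on `[−b,b]`, total integral `0`
  set φ : ℝ → ℂ := fun u ↦ (F : ℝ → ℂ) u * ((𝓕 H : Lp ℂ 2 (volume : Measure ℝ)) : ℝ → ℂ) u with hφ
  have hφi : Integrable φ := (Lp.memLp F).integrable_mul (Lp.memLp _)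
  have hφ_even : ∀ᵐ u : ℝ, φ (-u) = φ u := by
    filter_upwards [hFeven, hFH_even] with u h1 h2
    rw [hφ]; dsimp only; rw [h1, h2]
  have hφ_zero : ∀ᵐ u : ℝ, u ∈ Icc (-b) b → φ u = 0 := by
    filter_upwards [hFb] with u hu huI
    rw [hφ]; dsimp only; rw [hu huI, zero_mul]
  have hφ_int : ∫ u, φ u = 0 := by
    rw [hφ]; dsimp only
    rw [integral_mul_fourier_eq F H, hFdef, hFF]
    refine integral_eq_zero_of_ae ?_
    filter_upwards [hHcoe, hfa] with x h1 h2
    rw [h1, Pi.zero_apply]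
    by_cases hx : x ∈ Ioo (-a) a
    · rw [h2 (Ioo_subset_Icc_self hx), zero_mul]
    · rw [Set.indicator_of_notMem hx, mul_zero]
  have key := integral_eq_two_mul_setIntegral_Ioi hb hφi hφ_even hφ_zero
  rw [hφ_int] at key
  have hzero : ∫ u in Ioi b, φ u = 0 := by
    have := key.symm
    simpa using this
  rw [← hzero]
  refine integral_congr_ae ?_
  filter_upwards [ae_restrict_of_ae (s := Ioi b) hFH] with u hu
  rw [hφ]; dsimp only; rw [hu]

/-! ## D. The functional equation (1.1) -/

include ha hb hf in
/-- (1.1) on `Re s > 1`. [cite: Burnol2001CRAS, eq. (1.1) (TeX l.279–281)] -/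
private theorem sonineMellinExt_fourier_eq_of_one_lt {s : ℂ} (hs : 1 < s.re) :
    sonineMellinExt a b ((𝓕 f : Lp ℂ 2 (volume : Measure ℝ)) : ℝ → ℂ) s =
      gammaPlus s * sonineMellinExt b a (f : ℝ → ℂ) (1 - s) := by
  have hs0 : 0 < s.re := by linarith
  have hs2 : 1 / 2 < s.re := by linarith
  rw [show sonineMellinExt a b ((𝓕 f : Lp ℂ 2 (volume : Measure ℝ)) : ℝ → ℂ) s =
    ∫ u in Ioi b, ((𝓕 f : Lp ℂ 2 (volume : Measure ℝ)) : ℝ → ℂ) u * cosKernel a u s from rfl]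
  -- closed form (1.3) on `(b,∞)`
  have e1 : ∫ u in Ioi b, ((𝓕 f : Lp ℂ 2 (volume : Measure ℝ)) : ℝ → ℂ) u * cosKernel a u s =
      ∫ u in Ioi b, (((𝓕 f : Lp ℂ 2 (volume : Measure ℝ)) : ℝ → ℂ) u * (gammaPlus s * (u : ℂ) ^ (-s)) -
        ((𝓕 f : Lp ℂ 2 (volume : Measure ℝ)) : ℝ → ℂ) u *
          (2 * ∫ t in Ioc 0 a, ((Real.cos (2 * π * u * t) : ℝ) : ℂ) * (t : ℂ) ^ (s - 1))) := by
    refine setIntegral_congr_fun measurableSet_Ioi (fun u hu ↦ ?_)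
    have hu0 : 0 < u := hb.trans hu
    have hBC : IsBurnolC a u (cosKernel a u) :=
      ⟨differentiable_cosKernel ha hu0.ne', fun z hz ↦ cosKernel_eq_burnolC ha hu0.ne' hz⟩
    rw [hBC.eq_closedForm ha hu0 hs0, mul_sub]
  have hI1 : IntegrableOn (fun u : ℝ ↦ ((𝓕 f : Lp ℂ 2 (volume : Measure ℝ)) : ℝ → ℂ) u *
      (gammaPlus s * (u : ℂ) ^ (-s))) (Ioi b) := by
    have h0 : IntegrableOn (fun u : ℝ ↦ gammaPlus s *
        (((𝓕 f : Lp ℂ 2 (volume : Measure ℝ)) : ℝ → ℂ) u * (u : ℂ) ^ (-s))) (Ioi b) :=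
      (integrableOn_fourier_mul_cpow (f := f) hb hs2).const_mul (gammaPlus s)
    exact h0.congr_fun (fun u _ ↦ by ring) measurableSet_Ioi
  have hI2 : IntegrableOn (fun u : ℝ ↦ ((𝓕 f : Lp ℂ 2 (volume : Measure ℝ)) : ℝ → ℂ) u *
      (2 * ∫ t in Ioc 0 a, ((Real.cos (2 * π * u * t) : ℝ) : ℂ) * (t : ℂ) ^ (s - 1))) (Ioi b) := by
    -- a.e. equal to the integrable `𝓕f · 𝓕H`
    have hh1 := integrable_hs a hs
    have hh2 := memLp_hs a hs
    have hi : Integrable (fun u : ℝ ↦ ((𝓕 f : Lp ℂ 2 (volume : Measure ℝ)) : ℝ → ℂ) u *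
        ((𝓕 (hh2.toLp _) : Lp ℂ 2 (volume : Measure ℝ)) : ℝ → ℂ) u) :=
      (Lp.memLp _).integrable_mul (Lp.memLp _)
    refine hi.integrableOn.congr_fun_ae ?_
    filter_upwards [ae_restrict_of_ae (s := Ioi b) (fourier_toLp_ae_eq_fourierIntegral hh1 hh2)]
      with u hu
    rw [hu, fourier_indicator_abs_cpow a hs]
  rw [e1, integral_sub hI1 hI2, setIntegral_fourier_mul_cosIntegral_eq_zero hb hf hs, sub_zero]
  have e2 : ∫ u in Ioi b, ((𝓕 f : Lp ℂ 2 (volume : Measure ℝ)) : ℝ → ℂ) u *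
      (gammaPlus s * (u : ℂ) ^ (-s)) = gammaPlus s *
        ∫ u in Ioi b, ((𝓕 f : Lp ℂ 2 (volume : Measure ℝ)) : ℝ → ℂ) u * (u : ℂ) ^ (-s) := by
    rw [← integral_const_mul]
    refine integral_congr_ae (Eventually.of_forall fun u ↦ ?_)
    dsimp only; ring
  rw [e2, setIntegral_fourier_mul_cpow ha hb hf hs2]

/-- `γ₊` is holomorphic on `Re s > 0` (no pole of `Γ` there). [cite: Burnol2001CRAS, §1 (TeX l.276–279)] -/
theorem differentiableAt_gammaPlus {s : ℂ} (hs : 0 < s.re) : DifferentiableAt ℂ gammaPlus s := by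
  have hΓ : DifferentiableAt ℂ Complex.Gamma s :=
    Complex.differentiableAt_Gamma s fun m h ↦ by
      have := congrArg Complex.re h
      simp at this
      linarith [m.cast_nonneg (α := ℝ)]
  have h2π : (2 * π : ℂ) ≠ 0 := by exact_mod_cast (by positivity : (2 * π : ℝ) ≠ 0)
  unfold gammaPlus
  have h1 : DifferentiableAt ℂ (fun s : ℂ ↦ (2 * π : ℂ) ^ (-s)) s :=
    differentiableAt_id.neg.const_cpow (Or.inl h2π)
  have h3 : DifferentiableAt ℂ (fun s : ℂ ↦ Complex.cos (π * s / 2)) s := by fun_prop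
  exact ((h1.const_mul _).mul h3).mul hΓ

include ha hb hf in
/-- **Eq. (1.1) as an identity of entire functions (Burnol 2001)**: for `f ∈ K_{a,b}` and `Re s > 0`,
`G_f(s) = γ₊(s)·G_{𝓕f}(1 − s)`, where `G_f = sonineMellinExt a b (𝓕f)` and
`G_{𝓕f} = sonineMellinExt b a f` are the entire continuations of `f̂` and `(𝓕₊f)^` ("presque partout
sur la droite critique: `f̂(s) = γ₊(s)(𝓕₊f)^(1−s)`" — here off the critical line as well, on the
half-plane where Mathlib's `Γ` carries no junk values). [cite: Burnol2001CRAS, eq. (1.1) (TeX l.279–281)] -/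
theorem sonineMellinExt_fourier_eq_gammaPlus_mul {s : ℂ} (hs : 0 < s.re) :
    sonineMellinExt a b ((𝓕 f : Lp ℂ 2 (volume : Measure ℝ)) : ℝ → ℂ) s =
      gammaPlus s * sonineMellinExt b a (f : ℝ → ℂ) (1 - s) := by
  set U : Set ℂ := {s : ℂ | 0 < s.re} with hU
  have hUo : IsOpen U := isOpen_lt continuous_const Complex.continuous_re
  have hUc : IsPreconnected U := (convex_halfSpace_re_gt 0).isPreconnected
  have h1 : AnalyticOnNhd ℂ (sonineMellinExt a b ((𝓕 f : Lp ℂ 2 (volume : Measure ℝ)) : ℝ → ℂ)) U :=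
    (differentiable_sonineMellinExt ha hb _).differentiableOn.analyticOnNhd hUo
  have h2d : DifferentiableOn ℂ (fun s : ℂ ↦ gammaPlus s * sonineMellinExt b a (f : ℝ → ℂ) (1 - s)) U := by
    intro z hz
    refine ((differentiableAt_gammaPlus hz).mul ?_).differentiableWithinAt
    exact ((differentiable_sonineMellinExt hb ha f).comp
      ((differentiable_const (1 : ℂ)).sub differentiable_id)).differentiableAt
  have h2 : AnalyticOnNhd ℂ (fun s : ℂ ↦ gammaPlus s * sonineMellinExt b a (f : ℝ → ℂ) (1 - s)) U :=
    h2d.analyticOnNhd hUo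
  have hz₀ : (2 : ℂ) ∈ U := by simp [hU]
  have hV : IsOpen {s : ℂ | 1 < s.re} := isOpen_lt continuous_const Complex.continuous_re
  have hev : sonineMellinExt a b ((𝓕 f : Lp ℂ 2 (volume : Measure ℝ)) : ℝ → ℂ) =ᶠ[𝓝 (2 : ℂ)]
      fun s : ℂ ↦ gammaPlus s * sonineMellinExt b a (f : ℝ → ℂ) (1 - s) := by
    filter_upwards [hV.mem_nhds (by simp : (2 : ℂ) ∈ {s : ℂ | 1 < s.re})] with z hz
    exact sonineMellinExt_fourier_eq_of_one_lt ha hb hf hz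
  exact h1.eqOn_of_preconnected_of_eventuallyEq h2 hUc hz₀ hev hs

end Main

/-! ## E. Non-vacuity of the compensated pairing (Théorème 1.5) -/

/-- **The compensated pairing function of Théorème 1.5 exists** (faithful form): for `f ∈ K_{λ,λ}`
with entire Mellin continuation `G`, the entire function `P = G_{𝓕f} = sonineMellinExt λ λ f`
satisfies `P(v) = γ₊(v) G(1 − v)` on `Re v > 0` — this is `IsXPairingFnC G P` of
`BurnolSonineSpaces.lean`, unfolded ("On notera en particulier la compensation entre les pôles de
`γ₊(w)` et les zéros triviaux de `f̂(1−w)`", TeX l.402–403). [cite: Burnol2001CRAS, §1 (TeX l.398–403)] -/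
theorem exists_compensated_pairing_fn {lam : ℝ} (hlam : 0 < lam) {f : Lp ℂ 2 (volume : Measure ℝ)}
    (hf : f ∈ soninSpace lam lam) {G : ℂ → ℂ} (hG : HasEntireMellin f G) :
    ∃ P : ℂ → ℂ, Differentiable ℂ P ∧ ∀ v : ℂ, 0 < v.re → P v = gammaPlus v * G (1 - v) := by
  obtain ⟨hFmem, hFF⟩ := fourier_mem_soninSpace_swap hf
  obtain ⟨heven, hfa, hFb⟩ := hf
  -- `G = sonineMellinExt λ λ (𝓕f)` (uniqueness of the entire continuation)
  have hGeq : G = sonineMellinExt lam lam ((𝓕 f : Lp ℂ 2 (volume : Measure ℝ)) : ℝ → ℂ) := by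
    have hW : IsOpen {w : ℂ | w.re < 1 / 2} := isOpen_lt Complex.continuous_re continuous_const
    have hev : G =ᶠ[𝓝 (0 : ℂ)] sonineMellinExt lam lam ((𝓕 f : Lp ℂ 2 (volume : Measure ℝ)) : ℝ → ℂ) := by
      filter_upwards [hW.mem_nhds (by norm_num : (0 : ℂ) ∈ {w : ℂ | w.re < 1 / 2})] with z hz
      rw [hG.2 z hz, sonineMellinExt_eq_mellin hlam hlam f heven hfa hFb hz]
    have h1 : AnalyticOnNhd ℂ G univ := hG.1.differentiableOn.analyticOnNhd isOpen_univ
    have h2 : AnalyticOnNhd ℂ (sonineMellinExt lam lam ((𝓕 f : Lp ℂ 2 (volume : Measure ℝ)) : ℝ → ℂ))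
        univ := (differentiable_sonineMellinExt hlam hlam _).differentiableOn.analyticOnNhd isOpen_univ
    exact funext fun z ↦
      h1.eqOn_of_preconnected_of_eventuallyEq h2 isPreconnected_univ (mem_univ 0) hev (mem_univ z)
  refine ⟨sonineMellinExt lam lam (f : ℝ → ℂ), differentiable_sonineMellinExt hlam hlam f,
    fun v hv ↦ ?_⟩
  -- (1.1) for `𝓕f ∈ K_{λ,λ}`, `𝓕𝓕f = f`
  have key := sonineMellinExt_fourier_eq_gammaPlus_mul hlam hlam hFmem hv
  rw [hFF] at key
  rw [hGeq]
  exact key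

end Burnol2001

end Literature.Analysis.DeBrangesSpaces
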